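import Summits.ResolutionOfSingularities.ResolutionOfSingularities.Theorems.HilbertSamuelEliminationSigmaMaxModificationsCorridor3SigmaSurfaceBadnessCureLists
import Literature.AlgebraicGeometry.Resolution.CartierDivisorControlledTransformReduced
import Literature.AlgebraicGeometry.Resolution.Hironaka2005CompletionOrders
import Literature.AlgebraicGeometry.Resolution.TransformContainmentOffCentre
import Literature.AlgebraicGeometry.Hironaka2017.Lib.MonomialComponentCount
import HarnessLib

/-!
# [OURS · L1 W4.2] σ-LAYER PHASE B′ — `Corridor3SigmaSurfaceBadnessPointCure`: THE CURE-POINT STEP ON THE CARRIER (blowing up a point `x` of the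
# configuration: members through `x` ↦ controlled transform `ρᶜ(Γ, 1)`, other members ↦ total transform, the exceptional divisor adjoined last) and its laws
# OFF THE EXCEPTIONAL DIVISOR: stalks, supports, orders, multiplicity lists, codimension-one points and specialisations are read through `ρ`, which is a local
# isomorphism there
# (res-L1-w42-stub-1 DESIGN CHECK 2 (b): the cure at a counted same-member crossing is the POINT step; carrier model of the run's `E.next C` at a point centre under
# coincidence — res-type-067 `comap_strictTransformHom_controlledTransform`; crux chain w42 `SigmaMaxModifications` stmt-ResolutionOfSingularities-18506 / conjunct
# `SigmaMaxModificationsCorridor3` stmt-ResolutionOfSingularities-19249; helper of res-L1-w42-stub-1 (gen 6), `--supports stmt-…-19249 --as helper`, counted 0)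

HONEST FRAMING. OURS bookkeeping over the tree's blow-up dictionary off the centre (`IsBlowup.stalkIdeal_controlledTransform_of_not_mem`,
`IsBlowup.isIso_stalkMap_of_not_mem_support`, `IsBlowup.coheight_eq_of_not_mem`, `IsBlowup.exists_eq_of_not_mem_support`, `IsBlowup.isIso_compl`,
`MonomialComponent.injOn_compl_support`, `idealOrder_comap_of_isIso_stalkMap`; Stacks 02OS) and this seat's `Boundary.compMults` (p559520) / list kernels (p564426).
The exceptional divisor's own bookkeeping and the drop of `M` are in the sequel. NOTHING here is a statement of H. Hironaka's manuscript [Hironaka2017] nor of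
[CossartJannsenSaito2020]; no named fact. AI-written; AI review is weaker than expert review.

## Contents (namespace `…Theorems.SigmaMaxModificationsCorridor3.Sigma`)

* `pointCureMember x ρ P Γ`, **`Boundary.pointCure Γs x ρ P`** (`Γs.map (pointCureMember x ρ P) ++ [P.comap ρ]`).
* Off the exceptional divisor (`ρ x' ≠ x`, `V(P) = {x}`): `stalkIdeal_pointCureMember_of_ne`, `mem_support_pointCureMember_iff_of_ne`, `idealOrder_pointCureMember_of_ne`,
  `not_mem_support_comap_centre_of_ne`, `membersThrough_pointCure_of_ne`, **`Boundary.compMults_pointCure_of_ne`**, `Boundary.mem_divisorSet_pointCure_iff_of_ne`,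
  `Boundary.mem_codimOnePoints_pointCure_iff_of_ne`, `specializes_iff_of_not_mem` (specialisations between points off the exceptional divisor),
  `divisorialPoints_pointCureMember_of_ne`.

VACUITY SELF-CHECK. Definitions + transport along the local isomorphism `ρ|_{D′ ∖ E} ≅ D ∖ {x}`; hypotheses `IsBlowup ρ P`, `V(P) = {x}` only.
-/

noncomputable section

set_option linter.dupNamespace false -- mandated namespace of this single-conjunct summit

open CategoryTheory AlgebraicGeometry TopologicalSpace IsLocalRing
open Summit.ResolutionOfSingularities.ResolutionOfSingularities.Theorems.CampaignW42
open Literature.AlgebraicGeometry.Resolution Literature.RingTheory.HilbertSamuel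

namespace Summit.ResolutionOfSingularities.ResolutionOfSingularities.Theorems.SigmaMaxModificationsCorridor3.Sigma

universe u

open Scheme.IdealSheafData

/-! ## The point-cured list -/

section Defs

variable {D D' : Scheme.{u}}

open scoped Classical in
/-- [OURS · L1 W4.2] **THE POINT-CURED MEMBER**: under the blow-up `ρ` of the point `x` (centre ideal `P`), a member through `x` becomes its controlled transform
`ρᶜ(Γ, 1) = (ρ^*Γ : 𝓘_E)` (one copy of the exceptional divisor removed — CJS's principal strict transform restricted to the surface), a member not through `x` its
total transform. NOT a statement of the manuscript. [folklore] -/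
def pointCureMember (x : D) (ρ : D' ⟶ D) (P : D.IdealSheafData) (Γ : D.IdealSheafData) : D'.IdealSheafData :=
  if x ∈ (Γ.support : Set D) then controlledTransform ρ P Γ 1 else Γ.comap ρ

/-- [OURS · L1 W4.2] **THE TRACE LIST CURED AT THE POINT `x`**: every member point-cured, then the exceptional divisor `ρ^*P` adjoined as the NEW (last) member.
NOT a statement of the manuscript. [folklore] -/
def Boundary.pointCure (Γs : Boundary D) (x : D) (ρ : D' ⟶ D) (P : D.IdealSheafData) : Boundary D' :=
  Γs.map (pointCureMember x ρ P) ++ [P.comap ρ]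

variable {x : D} {ρ : D' ⟶ D} {P : D.IdealSheafData}

/-- Unfolding. [folklore] -/
theorem pointCureMember_of_mem {Γ : D.IdealSheafData} (h : x ∈ (Γ.support : Set D)) : pointCureMember x ρ P Γ = controlledTransform ρ P Γ 1 := by
  classical
  exact if_pos h

/-- Unfolding. [folklore] -/
theorem pointCureMember_of_not_mem {Γ : D.IdealSheafData} (h : x ∉ (Γ.support : Set D)) : pointCureMember x ρ P Γ = Γ.comap ρ := by
  classical
  exact if_neg h

/-- Membership in the point-cured list. [folklore] -/
theorem Boundary.mem_pointCure_iff {Γs : Boundary D} {J : D'.IdealSheafData} :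
    J ∈ Γs.pointCure x ρ P ↔ (∃ Γ ∈ Γs, pointCureMember x ρ P Γ = J) ∨ J = P.comap ρ := by
  simp [Boundary.pointCure, List.mem_append, List.mem_map]

end Defs

/-! ## Off the exceptional divisor -/

section OffCentre

variable {D D' : Scheme.{u}} {x : D} {ρ : D' ⟶ D} {P : D.IdealSheafData} (hρ : IsBlowup ρ P) (hPx : (P.support : Set D) = {x})

include hPx in
/-- Off the exceptional divisor means: not over the centre. [folklore] -/
theorem not_mem_support_centre_of_ne {x' : D'} (hx' : ρ.base x' ≠ x) : ρ.base x' ∉ (P.support : Set D) := by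
  rw [hPx]; exact hx'

include hρ hPx in
/-- **Stalks off the exceptional divisor**: the point-cured member has the stalk of the total transform. [folklore] -/
theorem stalkIdeal_pointCureMember_of_ne (Γ : D.IdealSheafData) {x' : D'} (hx' : ρ.base x' ≠ x) :
    stalkIdeal (pointCureMember x ρ P Γ) x' = stalkIdeal (Γ.comap ρ) x' := by
  by_cases h : x ∈ (Γ.support : Set D)
  · rw [pointCureMember_of_mem h]
    exact hρ.stalkIdeal_controlledTransform_of_not_mem Γ 1 (not_mem_support_centre_of_ne hPx hx')
  · rw [pointCureMember_of_not_mem h]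

include hρ hPx in
/-- **Supports off the exceptional divisor**: `x' ∈ supp (cured Γ) ↔ ρ x' ∈ supp Γ`. [folklore] -/
theorem mem_support_pointCureMember_iff_of_ne (Γ : D.IdealSheafData) {x' : D'} (hx' : ρ.base x' ≠ x) :
    x' ∈ ((pointCureMember x ρ P Γ).support : Set D') ↔ ρ.base x' ∈ (Γ.support : Set D) := by
  rw [SetLike.mem_coe, mem_support_iff_stalkIdeal_le, stalkIdeal_pointCureMember_of_ne hρ hPx Γ hx', ← mem_support_iff_stalkIdeal_le, ← SetLike.mem_coe,
    Boundary.coe_support_comap]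
  rfl

include hρ hPx in
/-- **Orders off the exceptional divisor**: `ord_{x'} (cured Γ) = ord_{ρ x'} Γ` (`𝒪_{D, ρ x'} ≅ 𝒪_{D′, x'}`). [cite: StacksProject, Tag 02OS] -/
theorem idealOrder_pointCureMember_of_ne (Γ : D.IdealSheafData) {x' : D'} (hx' : ρ.base x' ≠ x) :
    idealOrder (pointCureMember x ρ P Γ) x' = idealOrder Γ (ρ.base x') := by
  haveI := hρ.isIso_stalkMap_of_not_mem_support (not_mem_support_centre_of_ne hPx hx')
  rw [idealOrder_congr_stalkIdeal (stalkIdeal_pointCureMember_of_ne hρ hPx Γ hx')]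
  exact idealOrder_comap_of_isIso_stalkMap ρ x' Γ

include hPx in
/-- The new member (the exceptional divisor) does not pass through points off it. [folklore] -/
theorem not_mem_support_comap_centre_of_ne {x' : D'} (hx' : ρ.base x' ≠ x) : x' ∉ ((P.comap ρ).support : Set D') := by
  rw [Boundary.coe_support_comap, Set.mem_preimage]
  exact not_mem_support_centre_of_ne hPx hx'

include hPx in
/-- … and passes through every point over `x`. [folklore] -/
theorem mem_support_comap_centre_of_eq {x' : D'} (hx' : ρ.base x' = x) : x' ∈ ((P.comap ρ).support : Set D') := by
  rw [Boundary.coe_support_comap, Set.mem_preimage, hPx, hx']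
  rfl

include hρ hPx in
open scoped Classical in
/-- **The members of the point-cured list through a point off the exceptional divisor** are the cures of the members through its image. [folklore] -/
theorem membersThrough_pointCure_of_ne (Γs : Boundary D) {x' : D'} (hx' : ρ.base x' ≠ x) :
    membersThrough (Γs.pointCure x ρ P) x' = (membersThrough Γs (ρ.base x')).map (pointCureMember x ρ P) := by
  unfold membersThrough Boundary.pointCure
  rw [List.filter_append, List.filter_map, List.filter_singleton]
  have hP : ¬ (x' ∈ ((P.comap ρ).support : Set D')) := not_mem_support_comap_centre_of_ne hPx hx'
  rw [decide_eq_false hP, cond_false, List.append_nil]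
  exact List.filter_map_congr_aux Γs (pointCureMember x ρ P) (pointCureMember x ρ P) (fun Γ => ρ.base x' ∈ (Γ.support : Set D))
    (fun Γ => x' ∈ ((pointCureMember x ρ P Γ).support : Set D')) (fun Γ _ => mem_support_pointCureMember_iff_of_ne hρ hPx Γ hx') (fun _ _ _ => rfl)

include hρ hPx in
/-- **THE MULTIPLICITY LISTS OFF THE EXCEPTIONAL DIVISOR ARE THE OLD ONES**: `compMults (pointCure) x' = compMults Γs (ρ x')`. [folklore] -/
theorem Boundary.compMults_pointCure_of_ne (Γs : Boundary D) {x' : D'} (hx' : ρ.base x' ≠ x) :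
    (Γs.pointCure x ρ P).compMults x' = Γs.compMults (ρ.base x') := by
  unfold Boundary.compMults
  rw [membersThrough_pointCure_of_ne hρ hPx Γs hx', List.map_map]
  refine List.map_congr_left fun Γ _ => ?_
  simp only [Function.comp_apply]
  rw [idealOrder_pointCureMember_of_ne hρ hPx Γ hx']

include hρ hPx in
/-- **The configuration off the exceptional divisor is the preimage of the old one.** [folklore] -/
theorem Boundary.mem_divisorSet_pointCure_iff_of_ne (Γs : Boundary D) {x' : D'} (hx' : ρ.base x' ≠ x) :
    x' ∈ (Γs.pointCure x ρ P).divisorSet ↔ ρ.base x' ∈ Γs.divisorSet := by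
  rw [Boundary.mem_divisorSet_iff, Boundary.mem_divisorSet_iff]
  constructor
  · rintro ⟨J, hJ, hxJ⟩
    rcases Boundary.mem_pointCure_iff.mp hJ with ⟨Γ, hΓ, rfl⟩ | rfl
    · exact ⟨Γ, hΓ, (mem_support_pointCureMember_iff_of_ne hρ hPx Γ hx').mp hxJ⟩
    · exact absurd hxJ (not_mem_support_comap_centre_of_ne hPx hx')
  · rintro ⟨Γ, hΓ, hxΓ⟩
    exact ⟨pointCureMember x ρ P Γ, Boundary.mem_pointCure_iff.mpr (Or.inl ⟨Γ, hΓ, rfl⟩), (mem_support_pointCureMember_iff_of_ne hρ hPx Γ hx').mpr hxΓ⟩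

include hPx in
/-- Every point of the exceptional divisor lies in the new configuration (on the new member). [folklore] -/
theorem Boundary.mem_divisorSet_pointCure_of_eq (Γs : Boundary D) {x' : D'} (hx' : ρ.base x' = x) : x' ∈ (Γs.pointCure x ρ P).divisorSet :=
  Boundary.mem_divisorSet_iff.mpr ⟨P.comap ρ, Boundary.mem_pointCure_iff.mpr (Or.inr rfl), mem_support_comap_centre_of_eq hPx hx'⟩

include hρ hPx in
/-- **Codimension-one points off the exceptional divisor correspond.** [folklore] -/
theorem Boundary.mem_codimOnePoints_pointCure_iff_of_ne (Γs : Boundary D) {x' : D'} (hx' : ρ.base x' ≠ x) :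
    x' ∈ (Γs.pointCure x ρ P).codimOnePoints ↔ ρ.base x' ∈ Γs.codimOnePoints := by
  rw [Boundary.mem_codimOnePoints_iff, Boundary.mem_codimOnePoints_iff, Boundary.mem_divisorSet_pointCure_iff_of_ne hρ hPx Γs hx',
    hρ.coheight_eq_of_not_mem (not_mem_support_centre_of_ne hPx hx')]

include hρ hPx in
/-- **Divisorial points of a cured member off the exceptional divisor correspond.** [folklore] -/
theorem mem_divisorialPoints_pointCureMember_iff_of_ne (Γ : D.IdealSheafData) {x' : D'} (hx' : ρ.base x' ≠ x) :
    x' ∈ divisorialPoints (pointCureMember x ρ P Γ) ↔ ρ.base x' ∈ divisorialPoints Γ := by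
  rw [mem_divisorialPoints_iff, mem_divisorialPoints_iff, ← SetLike.mem_coe, mem_support_pointCureMember_iff_of_ne hρ hPx Γ hx',
    hρ.coheight_eq_of_not_mem (not_mem_support_centre_of_ne hPx hx')]
  rfl

include hρ hPx in
/-- **Specialisation between points off the exceptional divisor is read through `ρ`** (`ρ` restricts to an isomorphism `D′ ∖ E ≅ D ∖ {x}`, and specialisation
between points of an open subspace is computed inside it). [cite: StacksProject, Tag 02OS] -/
theorem specializes_iff_of_ne {ζ' y' : D'} (hζ' : ρ.base ζ' ≠ x) (hy' : ρ.base y' ≠ x) : ρ.base ζ' ⤳ ρ.base y' ↔ ζ' ⤳ y' := by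
  refine ⟨fun h => ?_, fun h => h.map ρ.continuous⟩
  set W₀ : D.Opens := ⟨(P.support : Set D)ᶜ, P.support.isClosed.isOpen_compl⟩ with hW₀
  haveI : IsIso (ρ ∣_ W₀) := hρ.isIso_compl
  have hζ₀ : ζ' ∈ ρ ⁻¹ᵁ W₀ := not_mem_support_centre_of_ne hPx hζ'
  have hy₀ : y' ∈ ρ ⁻¹ᵁ W₀ := not_mem_support_centre_of_ne hPx hy'
  -- inside the open subschemes
  have h1 : (⟨ρ.base ζ', not_mem_support_centre_of_ne hPx hζ'⟩ : W₀) ⤳ (⟨ρ.base y', not_mem_support_centre_of_ne hPx hy'⟩ : W₀) :=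
    W₀.isOpenEmbedding'.isInducing.specializes_iff.mp h
  have h2 : (ρ ∣_ W₀).base ⟨ζ', hζ₀⟩ ⤳ (ρ ∣_ W₀).base ⟨y', hy₀⟩ := by
    have e₁ : (ρ ∣_ W₀).base ⟨ζ', hζ₀⟩ = ⟨ρ.base ζ', not_mem_support_centre_of_ne hPx hζ'⟩ := Subtype.ext (morphismRestrict_base_coe ρ W₀ ⟨ζ', hζ₀⟩)
    have e₂ : (ρ ∣_ W₀).base ⟨y', hy₀⟩ = ⟨ρ.base y', not_mem_support_centre_of_ne hPx hy'⟩ := Subtype.ext (morphismRestrict_base_coe ρ W₀ ⟨y', hy₀⟩)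
    rw [e₁, e₂]; exact h1
  have h3 : (⟨ζ', hζ₀⟩ : ↥(ρ ⁻¹ᵁ W₀)) ⤳ ⟨y', hy₀⟩ := (ρ ∣_ W₀).isOpenEmbedding.isInducing.specializes_iff.mp h2
  exact (ρ ⁻¹ᵁ W₀).isOpenEmbedding'.isInducing.specializes_iff.mpr h3

include hρ hPx in
/-- `ρ` is injective off the exceptional divisor. [cite: StacksProject, Tag 02OS] -/
theorem eq_of_base_eq_of_ne {ζ' y' : D'} (hζ' : ρ.base ζ' ≠ x) (hy' : ρ.base y' ≠ x) (h : ρ.base ζ' = ρ.base y') : ζ' = y' :=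
  Literature.AlgebraicGeometry.Hironaka2017.MonomialComponent.injOn_compl_support hρ (not_mem_support_centre_of_ne hPx hζ')
    (not_mem_support_centre_of_ne hPx hy') h

include hρ hPx in
/-- Every point other than `x` has a (unique) preimage off the exceptional divisor. [cite: StacksProject, Tag 02OS] -/
theorem exists_base_eq_of_ne {y : D} (hy : y ≠ x) : ∃ y' : D', ρ.base y' = y :=
  hρ.exists_eq_of_not_mem_support (by rw [hPx]; exact hy)

end OffCentre

end Summit.ResolutionOfSingularities.ResolutionOfSingularities.Theorems.SigmaMaxModificationsCorridor3.Sigma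

end
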